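import Literature.NumberTheory.EllipticCurves.ZpExtensionLayerCharacter
import Literature.NumberTheory.EllipticCurves.ZpExtensionUnramifiedProofs
import Literature.NumberTheory.EllipticCurves.ZpExtensionProofs
import Literature.NumberTheory.GaloisRepresentations.ArtinCharacterLocalGlobalProofs
import Literature.NumberTheory.GaloisRepresentations.LocalArtinMapPinned
import Literature.NumberTheory.GaloisRepresentations.LAdicCharacterIdelicValuesProofs
import Literature.NumberTheory.GaloisRepresentations.KummerKeyStep
import Literature.NumberTheory.NumberFields.UnramifiedCompositum
import HarnessLib

/-!
# Layers of a `ℤ_p`-extension under the local norm residue symbols: the local symbol at a place,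
# the product formula over two places, and the layer subgroups (proofs only)

Topic `NumberTheory/EllipticCurves` (Iwasawa theory of `ℤ_p`-extensions); namespace
`Literature.NumberTheory.EllipticCurves.ZpExtension`.  THEOREMS ONLY (no definition, no named fact,
no instance; D-0026).  First half of the discharge of the named fact
`ZpExtension.exists_isFrobPow_mem_kerSubgroup_of_isAnticyclotomic`
(`AnticyclotomicPrimeDecomposition.lean`: the local norm residue symbol of `π̄/π` at a split prime
fixes the anticyclotomic tower); the second half is `AnticyclotomicLocalNormResidueSymbolProofs`.

For a number field `K`, a finite abelian `L ⊆ K̄` and a finite place `v`, write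
`ψ_L = artinIdeleMap L : 𝕀_K → G(L|K)` for the Artin map (Tate, Cassels–Fröhlich VII §4.2, tree
`GlobalArtinMapOfCharactersProofs`), `ι_v : K_vˣ → 𝕀_K` for the local idele (`localUnits v`),
`a_v = canonicalArtin K_v : W_{K_v} → K_vˣ` for THE local Artin map in Deligne's normalisation
(`LocalClassFieldTheory`, `isLocalArtinMap_canonicalArtin_holds`), `res_v : Γ_{K_v} → Γ_K`
(`absGaloisRestrict`) and `r_L : Γ_K → G(L|K)` (`absRestrictNormalHom`).

* §1 `absRestrictNormalHom_layer_eq_one_iff`, `mem_layerSubgroup_iff_forall_smul`: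
  `g|_{K_n} = 1 ↔ g ∈ κ⁻¹(pⁿℤ_p) ↔ g` fixes `K_n` pointwise (Washington §13.1; `⋂ₙ κ⁻¹(pⁿℤ_p) = ker κ`
  is the tree's `mem_kerSubgroup_of_forall_mem_layerSubgroup`).
* §2 `isUnramifiedIn_layer_of_not_mem`: the layers `K_n/K` are unramified at every `w ∤ p`
  (Washington Prop. 13.2, tree `inertia_le_kerSubgroup_holds`).
* §3 `absRestrictNormalHom_absGaloisRestrict_toAbsGalois_eq_inv`: **the local symbol**
  `r_L(res_v w) = ψ_L(ι_v(a_v w))⁻¹` for every `w ∈ W_{K_v}` — the tree's local–global compatibility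
  `ArtinLocalGlobal.artinIdeleMap_localUnits_mul_absRestrictNormalHom` (Neukirch VI (5.6)) read as an
  equation; with the valuation of `a_v w`: `|a_v w|_v = exp (deg w)` (`valued_artin_eq_exp_deg`).
* §4 `artinIdeleMap_localUnits_mul_eq_one_of_pair`: **product formula over two places** — for a
  totally complex `K`, a finite abelian `L` unramified outside `{v, v̄}` and `k ∈ Kˣ` a unit outside
  `{v, v̄}`: `ψ_L(ι_v k) · ψ_L(ι_v̄ k) = 1` (Artin reciprocity `ψ_L(Kˣ) = 1`, the principal idele of
  `k` split into its components, Neukirch VII §6 proof of (6.13); the infinite component is a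
  `#G(L|K)`-th power in `(K ⊗ ℝ)ˣ = ∏ ℂˣ`).

## References

* J. Tate, *Global class field theory*, Ch. VII of Cassels–Fröhlich (1967), §4.2, §6 Prop. 6.2.
  [CasselsFrohlichANT1967]
* J. Neukirch, *Algebraic Number Theory* (1999), Ch. VI (5.6), Ch. VII §6 (6.13). [NeukirchANT1999]
* L. C. Washington, *Introduction to Cyclotomic Fields* (1997), §13.1, Prop. 13.2. [Washington1997]
-/

noncomputable section

open Field NumberField IsDedekindDomain

namespace Literature.NumberTheory.EllipticCurves.ZpExtension

open Literature.NumberTheory.GaloisRepresentations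

/-! ### §1. Layer subgroups -/

section Layers

variable {K : Type} [Field K] [NumberField K] {p : ℕ} [Fact p.Prime] (κ : ZpExtension K p)

/-- **`g|_{K_n} = 1 ↔ g ∈ κ⁻¹(pⁿ ℤ_p)`**: the restriction of `g ∈ Γ_K` to the layer `K_n` is trivial
iff `g` lies in the layer subgroup (Krull–Galois correspondence, `galFixing K (κ.layer n) =
κ.layerSubgroup n`, tree `exists_cyclicCharacter_layer`). [cite: Washington1997, §13.1] -/
theorem absRestrictNormalHom_layer_eq_one_iff (n : ℕ) [Normal K (κ.layer n)]
    (g : absoluteGaloisGroup K) :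
    absRestrictNormalHom (κ.layer n) g = 1 ↔ g ∈ κ.layerSubgroup n := by
  obtain ⟨ψ, hker, hker', -⟩ := κ.exists_cyclicCharacter_layer n
  rw [← hker, hker', LocalWeilDatum.mem_galFixing_iff,
    NumberFields.absRestrictNormalHom_eq_one_iff_forall_smul (κ.layer n) g]
  exact ⟨fun h x hx => h ⟨x, hx⟩, fun h x => h x x.2⟩

/-- Membership form of the Galois correspondence for a layer: `g ∈ κ⁻¹(pⁿℤ_p)` iff `g` fixes
`K_n` pointwise. [cite: Washington1997, §13.1] -/
theorem mem_layerSubgroup_iff_forall_smul (n : ℕ) (g : absoluteGaloisGroup K) :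
    g ∈ κ.layerSubgroup n ↔ ∀ x ∈ κ.layer n, g • x = x := by
  obtain ⟨ψ, hker, hker', -⟩ := κ.exists_cyclicCharacter_layer n
  rw [← hker, hker', LocalWeilDatum.mem_galFixing_iff]

end Layers

/-! ### §2. The layers are unramified outside `p` -/

section Unramified

variable {K : Type} [Field K] [NumberField K] {p : ℕ} [Fact p.Prime] (κ : ZpExtension K p)

/-- **The layer `K_n/K` of a `ℤ_p`-extension is unramified at every finite place `w ∤ p`**: the
inertia groups above `w` lie in `ker κ ≤ κ⁻¹(pⁿℤ_p) = Gal(K̄/K_n)` (Washington Prop. 13.2, tree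
`inertia_le_kerSubgroup_holds`), so they die in `Gal(K_n/K)` (Neukirch VII §10, tree
`isUnramifiedIn_iff_forall_inertia_absRestrictNormalHom_eq_one`).
[cite: Washington1997, §13.1 Prop. 13.2] [cite: NeukirchANT1999, Ch. VII §10 Thm. (10.6) (proof)] -/
theorem isUnramifiedIn_layer_of_not_mem (n : ℕ) {w : HeightOneSpectrum (𝓞 K)}
    (hpw : ((p : ℕ) : 𝓞 K) ∉ w.asIdeal) :
    Algebra.IsUnramifiedIn (𝓞 (κ.layer n)) w.asIdeal := by
  haveI : FiniteDimensional K (κ.layer n) := κ.finiteDimensional_layer_holds n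
  haveI : IsGalois K (κ.layer n) := κ.isGalois_layer_holds n
  rw [NumberFields.isUnramifiedIn_iff_forall_inertia_absRestrictNormalHom_eq_one]
  intro 𝔓 h𝔓 g hg
  have hg' : g ∈ κ.layerSubgroup n :=
    κ.kerSubgroup_le_layerSubgroup n (inertia_le_kerSubgroup_holds K p κ hpw h𝔓 hg)
  exact (κ.absRestrictNormalHom_layer_eq_one_iff n g).mpr hg'

end Unramified

end Literature.NumberTheory.EllipticCurves.ZpExtension

/-! ### §3. The local symbol `r_L(res_v w) = ψ_L(ι_v(a_v w))⁻¹` and the valuation of `a_v w` -/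

namespace Literature.NumberTheory.GaloisRepresentations

namespace ArtinLocalGlobal

open ValuativeRel

variable {K : Type} [Field K] [NumberField K] (v : HeightOneSpectrum (𝓞 K))

/-- **`|a w|_v = exp (deg w)`** for a local Artin map `a` of `K_v` in Deligne's normalisation and
every `w ∈ W_{K_v}`: `w = u ^ {deg w} · i` with `deg u = 1`, `i` inert; `a(u⁻¹)` is a uniformiser
(`|·|_v = exp (-1)`) and `a(i)` a unit. [cite: TateCorvallis1979, (1.4.1)] -/
theorem valued_artin_eq_exp_deg {a : WeilGroup (v.adicCompletion K) →* (v.adicCompletion K)ˣ}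
    (ha : IsLocalArtinMap (v.adicCompletion K) a) (w : WeilGroup (v.adicCompletion K)) :
    Valued.v ((a w : (v.adicCompletion K)ˣ) : v.adicCompletion K) =
      WithZero.exp (WeilGroup.deg w) := by
  obtain ⟨u, hu⟩ := exists_deg_eq_one v
  obtain ⟨i, hi, hw⟩ := exists_eq_zpow_mul_inertia v hu w
  -- `|a u|_v = exp 1`
  have hdeg : WeilGroup.deg u⁻¹ = -1 := by
    rw [WeilGroup.deg_inv IsFrobPow.mul_holds IsFrobPow.unique_holds, hu]
  have hϖ := valued_eq_exp_neg_one_of_isUniformizer v (ha.artin_frob u⁻¹ hdeg)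
  rw [map_inv, Units.val_inv_eq_inv_val, map_inv₀] at hϖ
  have hau : Valued.v ((a u : (v.adicCompletion K)ˣ) : v.adicCompletion K) = WithZero.exp 1 := by
    rw [← inv_inj, hϖ, ← WithZero.exp_neg]
  -- `|a i|_v = 1`
  have hai : Valued.v ((a i : (v.adicCompletion K)ˣ) : v.adicCompletion K) = 1 := by
    have hmem : a i ∈ (valuation (v.adicCompletion K)).valuationSubring.unitGroup := by
      rw [← ha.image_inertia]; exact Subgroup.mem_map_of_mem a hi
    rw [Valuation.mem_unitGroup_iff] at hmem
    have hle : ∀ x y : v.adicCompletion K,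
        valuation (v.adicCompletion K) x ≤ valuation (v.adicCompletion K) y ↔ Valued.v x ≤ Valued.v y :=
      fun x y => (Valuation.vle_iff_le (valuation (v.adicCompletion K))).symm.trans
        (Valuation.vle_iff_le Valued.v)
    refine le_antisymm ?_ ?_
    · rw [← (Valued.v : Valuation (v.adicCompletion K) (WithZero (Multiplicative ℤ))).map_one, ← hle,
        (valuation (v.adicCompletion K)).map_one, hmem]
    · rw [← (Valued.v : Valuation (v.adicCompletion K) (WithZero (Multiplicative ℤ))).map_one, ← hle,
        (valuation (v.adicCompletion K)).map_one, hmem]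
  set d := WeilGroup.deg w with hd
  rw [hw, map_mul, Units.val_mul, map_mul, hai, mul_one, map_zpow, Units.val_zpow_eq_zpow_val,
    map_zpow₀, hau, ← WithZero.exp_zsmul, smul_eq_mul, mul_one]

/-- A local Artin map of `K_v` is onto `K_vˣ` (it is an open quotient map). [folklore] -/
private theorem artin_surjective {a : WeilGroup (v.adicCompletion K) →* (v.adicCompletion K)ˣ}
    (ha : IsLocalArtinMap (v.adicCompletion K) a) : Function.Surjective a :=
  ha.isOpenQuotientMap_artin.surjective

variable (L : IntermediateField K (AlgebraicClosure K)) [FiniteDimensional K L] [IsAbelianGalois K L]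
  [NumberField L]

/-- **The local symbol as an equation: `r_L(res_v w) = ψ_L(ι_v(a w))⁻¹`** for a local Artin map `a`
of `K_v` and every `w ∈ W_{K_v}` (the tree's `artinIdeleMap_localUnits_mul_absRestrictNormalHom`,
Neukirch VI (5.6), solved for the restriction). [cite: NeukirchANT1999, Ch. VI §5 Prop. (5.6)] -/
theorem absRestrictNormalHom_absGaloisRestrict_toAbsGalois_eq_inv
    {a : WeilGroup (v.adicCompletion K) →* (v.adicCompletion K)ˣ}
    (ha : IsLocalArtinMap (v.adicCompletion K) a) (w : WeilGroup (v.adicCompletion K)) :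
    absRestrictNormalHom L
        (absGaloisRestrict K (v.adicCompletion K) (WeilGroup.toAbsGalois (v.adicCompletion K) w)) =
      (artinIdeleMap L artinReciprocity_character_holds (localUnits v (a w)))⁻¹ :=
  eq_inv_of_mul_eq_one_right (artinIdeleMap_localUnits_mul_absRestrictNormalHom v L ha w)

end ArtinLocalGlobal

/-! ### §4. The product formula over two places -/

section ProductFormula

open HeckeCharacter

variable {K : Type} [Field K] [NumberField K]
variable (L : IntermediateField K (AlgebraicClosure K)) [FiniteDimensional K L] [IsAbelianGalois K L]
  [NumberField L]

/-- **The Artin map kills the infinite ideles of a totally complex field**: `(K ⊗ ℝ)ˣ = ∏_w ℂˣ` is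
divisible, so every infinite idele is a `#G(L|K)`-th power (tree `exists_pow_eq_infiniteIdele`).
[cite: NeukirchANT1999, Ch. VII §6 Prop. (6.9)] -/
theorem artinIdeleMap_infiniteIdeles_eq_one (hcomplex : ∀ w : InfinitePlace K, w.IsComplex)
    (y : (InfiniteAdeleRing K)ˣ) :
    artinIdeleMap L artinReciprocity_character_holds (infiniteIdeles K y) = 1 := by
  obtain ⟨t, rfl⟩ := exists_pow_eq_infiniteIdele hcomplex y
    (Monoid.exponent_pos.mpr (Monoid.ExponentExists.of_finite (G := L ≃ₐ[K] L)))
  rw [map_pow, map_pow, Monoid.pow_exponent_eq_one]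

/-- **Product formula over two places.**  Let `K` be totally complex, `L ⊆ K̄` finite abelian over `K`
unramified at every finite place other than `v, v̄`, and `k ∈ Kˣ` a unit at every finite place other
than `v, v̄` (`v ≠ v̄`).  Then `ψ_L(ι_v k) · ψ_L(ι_v̄ k) = 1`: the principal idele of `k` is killed by
`ψ_L` (Artin reciprocity, Tate VII 4.2 (ii)) and equals `ι_v(k) ι_v̄(k)` times its infinite component
(killed: a `#G`-th power) times a unit idele off `{v, v̄}` (killed: `ψ_L(⟨𝒪_wˣ⟩) = 1` at unramified `w`,
Tate 4.2 (iii)); tree `IdelicCharacter.map_infiniteIdeles_mul_prod_localUnits_eq_one` applied to the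
Hecke characters `χ ∘ ψ_L`. [cite: CasselsFrohlichANT1967, Ch. VII §4.2 Corollary (ii), (iii)]
[cite: NeukirchANT1999, Ch. VII §6 Prop. (6.13) (proof)] -/
theorem artinIdeleMap_localUnits_mul_eq_one_of_pair (hcomplex : ∀ w : InfinitePlace K, w.IsComplex)
    {v vbar : HeightOneSpectrum (𝓞 K)} (hne : v ≠ vbar)
    (hunr : ∀ w : HeightOneSpectrum (𝓞 K), w ≠ v → w ≠ vbar → Algebra.IsUnramifiedIn (𝓞 L) w.asIdeal)
    (k : Kˣ) (hk : ∀ w : HeightOneSpectrum (𝓞 K), w ≠ v → w ≠ vbar → w.valuation K (k : K) = 1) :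
    artinIdeleMap L artinReciprocity_character_holds (localUnits v (globalToLocalUnits v k)) *
      artinIdeleMap L artinReciprocity_character_holds (localUnits vbar (globalToLocalUnits vbar k)) = 1 := by
  classical
  refine algEquiv_eq_of_forall_character L fun χ => ?_
  rw [map_one, map_mul]
  -- the Hecke character `ω = χ ∘ ψ_L`
  set ω : HeckeCharacter K := charHecke L χ artinReciprocity_character_holds with hω
  have hωψ : ∀ x, ω x = χ (artinIdeleMap L artinReciprocity_character_holds x) := fun x =>
    (apply_artinIdeleMap L artinReciprocity_character_holds χ x).symm
  have hS : ∀ w ∉ ({v, vbar} : Finset (HeightOneSpectrum (𝓞 K))), ∀ u : (w.adicCompletionIntegers K)ˣ,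
      ω.toContinuousMonoidHom (localUnits w (Units.map ((w.adicCompletionIntegers K).subtype : _ →* _) u)) = 1 := by
    intro w hw u
    rw [Finset.mem_insert, Finset.mem_singleton, not_or] at hw
    change ω _ = 1
    rw [hωψ, artinIdeleMap_localUnits_integer L artinReciprocity_character_holds (hunr w hw.1 hw.2) u,
      map_one]
  have hk' : ∀ w ∉ ({v, vbar} : Finset (HeightOneSpectrum (𝓞 K))), w.valuation K (k : K) = 1 := by
    intro w hw
    rw [Finset.mem_insert, Finset.mem_singleton, not_or] at hw
    exact hk w hw.1 hw.2
  have h := IdelicCharacter.map_infiniteIdeles_mul_prod_localUnits_eq_one ω.toContinuousMonoidHom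
    (fun x hx => ω.map_principal hx) hS k hk'
  rw [Finset.prod_pair hne] at h
  change ω _ * (ω _ * ω _) = 1 at h
  rw [hωψ, hωψ, hωψ, artinIdeleMap_infiniteIdeles_eq_one L hcomplex, map_one, one_mul] at h
  exact h

end ProductFormula

end Literature.NumberTheory.GaloisRepresentations

end
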